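import Literature.NumberTheory.EllipticCurves.HeegnerPointsKolyvaginPrimaryClassesProofs
import Literature.NumberTheory.EllipticCurves.LocalRestrictionDegreeTorsion
import HarnessLib

/-!
# Kolyvagin's classes under change of level: `[m]_* c_{n′}(P) = c_d(P)` (`n′ = d·m`), and the
# descended class one level deeper is Selmer at the primes ramified in a quadratic extension

McCallum 1991, Lemma 4.6 (*"`p^{M′} d_M(n) = d_{M−M′}(n)` — clear from the definition"*) at the
level of the classes `c_M(n) ∈ H¹(K, E[p^M])` themselves: the tree's Kolyvagin class
`kolyvaginClass W n′ … P …` of a point `P` (the class of McCallum's cocycle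
`g ↦ gQ′ − Q′ − (g−1)P/n′`, `n′Q′ = P`, Gross 1991 (4.4)–(4.6)) is carried by the change-of-level
map `[m]_* : H¹(K, E[n′]) → H¹(K, E[d])` (`WeierstrassCurve.torsionH1ZSMul`, induced by
`m · : E[n′] → E[d]`, `n′ = d·m`) to the Kolyvagin class of the SAME point at level `d`:

* `KolyvaginCocycle.IsAdmissible.of_eq_mul`, `KolyvaginCocycle.mem_invPoints_of_eq_mul`,
  `exists_zsmul_eq_of_eq_mul` — the level-`d` admissibility data follow from the level-`n′` data;
* `torsionH1ZSMul_kolyvaginClass` — **`[m]_* c_{n′}(P) = c_d(P)`** (the root `mQ′` and the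
  uniqueness of `d`-th roots in the `d`-torsion-free subgroup `A`);
* `torsionH1ZSMul_two_mem_selmerLocalKer_and_resTorsion_eq_kolyvaginClass` — for an extension
  `L/K₀` of number fields of degree `≤ 2`, `W/K₀`, a Kolyvagin class
  `c′ = c_{n′}(P) ∈ H¹(L, E_L[n′])` (`n′ = 2d`) which is a restriction `c′ = res ξ′` and satisfies
  the Selmer local condition at every place of `L` above a finite place `v` of `K₀`: the class
  `[2]_* ξ′ ∈ H¹(K₀, E[d])` restricts to `c_d(P)` AND satisfies the Selmer local condition at `v`
  (this file's level change + the tree's `LocalRestrictionDegreeTorsion`).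

Use at `p = 2` (Heegner points, `K₀ = ℚ`, `L = K` imaginary quadratic): with all Kolyvagin primes
taken one level deeper (`n ∈ S(M+1)`), `c_{2^M}(n) = [2]_* c_{2^{M+1}}(n)` and the descent to `ℚ` of
`c_{2^M}(n)` obtained this way is Selmer at the prime(s) ramified in `K` — the genus component
`H¹(K_𝔮/ℚ_q, E(K_𝔮))` of a level-`M` descent is invisible over `K` and is killed by passing
through level `M+1`. (At a ramified `𝔮` the class `c(n)` is Selmer over `K` by good reduction and
`K_n/K` unramified at `𝔮` — Gross 1991 Prop. 6.2 (1) / McCallum Lemma 4.3 — not by complete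
splitting: for `K = ℚ(√−q)` and `ℓ` inert, `Frob_𝔮` is the element of order `2` of
`Gal(K_ℓ/K_1) ≅ 𝔽_{ℓ²}ˣ/𝔽_ℓˣ`.) Everything here is proved; no named fact is introduced.

## References

* W. G. McCallum, *Kolyvagin's work on Shafarevich–Tate groups*, LMS LN 153 (1991), §4
  (Lemma 4.1, Lemma 4.3, Lemma 4.6). [McCallumLMS1991]
* B. H. Gross, *Kolyvagin's work on modular elliptic curves*, LMS LN 153 (1991), §4 (4.4)–(4.6),
  Prop. 6.2. [GrossLMS1991]
* T. Dokchitser, V. Dokchitser, Ann. of Math. 172 (2010), Lemma 4.14 (proof).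
  [DokchitserDokchitserAnnals2010]
-/

noncomputable section

open scoped Classical
open scoped AddSubgroup

universe u

open Literature.NumberTheory.GaloisRepresentations WeierstrassCurve NumberField
open IsDedekindDomain (HeightOneSpectrum)

namespace Literature.NumberTheory.EllipticCurves

/-! ## Admissibility data under `d ∣ n′` -/

namespace KolyvaginCocycle

variable {G : Type*} [Group G] {M : Type*} [AddCommGroup M] [DistribMulAction G M]
  {A : AddSubgroup M} {d n' : ℤ}

/-- A `Γ`-stable `n′`-torsion-free subgroup is `d`-torsion-free for `n′ = d·m` (McCallum's (5) at the
lower level). [cite: McCallumLMS1991, §4 (5) and Lemma 4.6] -/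
theorem IsAdmissible.of_eq_mul (m : ℤ) (hdm : d * m = n') (hA : IsAdmissible G A n') :
    IsAdmissible G A d where
  smul_mem := hA.smul_mem
  eq_zero_of_zsmul := fun a ha hda ↦ hA.eq_zero_of_zsmul ha (by
    rw [← hdm, mul_comm, mul_zsmul, hda, zsmul_zero])

/-- `(g−1)P ∈ n′A` for all `g` implies `(g−1)P ∈ dA` for `n′ = d·m` (McCallum's (4) at the lower
level). [cite: McCallumLMS1991, §4 (4) and Lemma 4.6] -/
theorem mem_invPoints_of_eq_mul (m : ℤ) (hdm : d * m = n') {P : M} (hP : P ∈ invPoints G A n') :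
    P ∈ invPoints G A d := by
  refine ⟨hP.1, fun g ↦ ?_⟩
  obtain ⟨R, hR, hRe⟩ := hP.2 g
  exact ⟨m • R, A.zsmul_mem hR m, by rw [← mul_zsmul, hdm, hRe]⟩

end KolyvaginCocycle

/-! ## `[m]_* c_{n′}(P) = c_d(P)` -/

section Curve

open KolyvaginCocycle

variable {K : Type u} [Field K] (W : WeierstrassCurve K)

/-- `n′`-divisibility of `E(K̄)` gives `d`-divisibility for `n′ = d·m` (the `p^M`-division points of
McCallum's Lemma 4.1 at the lower level). [cite: McCallumLMS1991, §4 Lemma 4.1 and Lemma 4.6] -/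
theorem exists_zsmul_eq_of_eq_mul {d n' : ℤ} (m : ℤ) (hdm : d * m = n')
    (hdiv' : ∀ P : geomPoints W, ∃ Q : geomPoints W, n' • Q = P) (P : geomPoints W) :
    ∃ Q : geomPoints W, d • Q = P := by
  obtain ⟨Q', hQ'⟩ := hdiv' P
  exact ⟨m • Q', by rw [← mul_zsmul, hdm, hQ']⟩

/-- **McCallum's Lemma 4.6 for the classes: `[m]_* c_{n′}(P) = c_d(P)`** (`n′ = d·m`). If `Q′` is an
`n′`-th root of `P` then `mQ′` is a `d`-th root, and `m·((g−1)P/n′) = (g−1)P/d` by uniqueness of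
`d`-th roots in the `d`-torsion-free subgroup `A`; so `m` times McCallum's level-`n′` cocycle is his
level-`d` cocycle, value by value. [cite: McCallumLMS1991, §4 Lemma 4.1 and Lemma 4.6]
[cite: GrossLMS1991, §4 (4.4)–(4.6)] -/
theorem torsionH1ZSMul_kolyvaginClass {d n' : ℤ} (m : ℤ) (hm : n' ∣ d * m) (hdm : d * m = n')
    (hdiv' : ∀ P : geomPoints W, ∃ Q : geomPoints W, n' • Q = P)
    (hdiv : ∀ P : geomPoints W, ∃ Q : geomPoints W, d • Q = P)
    {A : AddSubgroup (geomPoints W)}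
    (hA' : IsAdmissible (Field.absoluteGaloisGroup K) A n')
    (hA : IsAdmissible (Field.absoluteGaloisGroup K) A d) {P : geomPoints W}
    (hP' : P ∈ invPoints (Field.absoluteGaloisGroup K) A n')
    (hP : P ∈ invPoints (Field.absoluteGaloisGroup K) A d) :
    torsionH1ZSMul W m hm (kolyvaginClass W n' hdiv' hA' P hP') =
      kolyvaginClass W d hdiv hA P hP := by
  obtain ⟨Q', hQ'⟩ := hdiv' P
  have hQ : d • (m • Q') = P := by rw [← mul_zsmul, hdm, hQ']
  rw [kolyvaginClass_eq_cls hA' hP' hQ', kolyvaginClass_eq_cls hA hP hQ]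
  unfold KolyvaginCocycle.cls torsionH1ZSMul
  rw [resH1Hom_id_oneCocycleClass]
  refine KolyvaginCocycle.oneCocycleClass_congr_val fun g ↦ ?_
  change m • (((cocycle hA' (continuous_smul_geomPoints W) hP' hQ').1 g : geomTorsion W n') :
      geomPoints W) = ((cocycle hA (continuous_smul_geomPoints W) hP hQ).1 g : geomPoints W)
  rw [coe_cocycle_apply, coe_cocycle_apply, zsmul_sub, zsmul_sub, smul_comm m g Q']
  congr 1
  obtain ⟨hR, hRn⟩ := rootIn_smul_sub_spec hP' g
  refine (rootIn_eq hA.eq_zero_of_zsmul (A.zsmul_mem hR m) ?_).symm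
  rw [← mul_zsmul, hdm, hRn]

/-- The same with the level-`d` data derived from the level-`n′` data (`m = 2`, `n′ = 2d`: one
level deeper at `p = 2`). [cite: McCallumLMS1991, §4 Lemma 4.6] -/
theorem torsionH1ZSMul_two_kolyvaginClass {d n' : ℤ} (hm : n' ∣ d * 2) (hdm : d * 2 = n')
    (hdiv' : ∀ P : geomPoints W, ∃ Q : geomPoints W, n' • Q = P)
    {A : AddSubgroup (geomPoints W)}
    (hA' : IsAdmissible (Field.absoluteGaloisGroup K) A n') {P : geomPoints W}
    (hP' : P ∈ invPoints (Field.absoluteGaloisGroup K) A n') :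
    torsionH1ZSMul W 2 hm (kolyvaginClass W n' hdiv' hA' P hP') =
      kolyvaginClass W d (exists_zsmul_eq_of_eq_mul W 2 hdm hdiv') (hA'.of_eq_mul 2 hdm) P
        (mem_invPoints_of_eq_mul 2 hdm hP') :=
  torsionH1ZSMul_kolyvaginClass W 2 hm hdm hdiv' _ hA' _ hP' _

end Curve

/-! ## The descended class one level deeper is Selmer at the places of degree `≤ 2` -/

section Descent

open KolyvaginCocycle

variable {K₀ : Type u} [Field K₀] [NumberField K₀] (W : WeierstrassCurve K₀)
variable (L : Type u) [Field L] [NumberField L] [Algebra K₀ L]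

/-- **One level deeper, the descent is Selmer.** Let `[L : K₀] ≤ 2`, `n′ = 2d`, and let
`c′ = c_{n′}(P) ∈ H¹(L, E_L[n′])` be a Kolyvagin class of the base change `E_L` which is a
restriction, `c′ = res ξ′` with `ξ′ ∈ H¹(K₀, E[n′])`, and which satisfies the Selmer local condition
at every place `w` of `L` above the finite place `v` of `K₀` (McCallum Lemma 4.3 / Gross Prop. 6.2
(1) at `w ∤ n`). Then `[2]_* ξ′ ∈ H¹(K₀, E[d])` restricts to the level-`d` class `c_d(P)` (Lemma 4.6)
AND satisfies the Selmer local condition at `v` — including at the places `v` ramified in `L`, where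
a class of level exactly `d` descending `c_d(P)` may fail it by a genus component
`H¹(L_w/K₀,v, E(L_w))`. [cite: McCallumLMS1991, §4 Lemma 4.3 and Lemma 4.6]
[cite: DokchitserDokchitserAnnals2010, Lemma 4.14 (proof)] -/
theorem torsionH1ZSMul_two_mem_selmerLocalKer_and_resTorsion_eq_kolyvaginClass
    (h2 : Module.finrank K₀ L ≤ 2) {d n' : ℤ} (hm : n' ∣ d * 2) (hdm : d * 2 = n')
    (hdiv' : ∀ P : geomPoints (W.baseChange L), ∃ Q : geomPoints (W.baseChange L), n' • Q = P)
    {A : AddSubgroup (geomPoints (W.baseChange L))}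
    (hA' : IsAdmissible (Field.absoluteGaloisGroup L) A n') {P : geomPoints (W.baseChange L)}
    (hP' : P ∈ invPoints (Field.absoluteGaloisGroup L) A n')
    {ξ' : galH1Torsion W n'}
    (hξ' : resTorsion W L n' ξ' = kolyvaginClass (W.baseChange L) n' hdiv' hA' P hP')
    (v : HeightOneSpectrum (𝓞 K₀))
    (hSel : ∀ w : HeightOneSpectrum (𝓞 L), w.asIdeal.LiesOver v.asIdeal →
      kolyvaginClass (W.baseChange L) n' hdiv' hA' P hP' ∈
        selmerLocalKer (W.baseChange L) (w.adicCompletion L) n') :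
    torsionH1ZSMul W 2 hm ξ' ∈ selmerLocalKer W (v.adicCompletion K₀) d ∧
      resTorsion W L d (torsionH1ZSMul W 2 hm ξ') =
        kolyvaginClass (W.baseChange L) d (exists_zsmul_eq_of_eq_mul (W.baseChange L) 2 hdm hdiv')
          (hA'.of_eq_mul 2 hdm) P (mem_invPoints_of_eq_mul 2 hdm hP') := by
  refine ⟨torsionH1ZSMul_two_mem_selmerLocalKer_of_forall_liesOver W L h2 hm v
    (fun w hw ↦ by rw [hξ']; exact hSel w hw), ?_⟩
  rw [resTorsion_torsionH1ZSMul, hξ', torsionH1ZSMul_two_kolyvaginClass (W.baseChange L) hm hdm]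

/-- **Selmer-group form.** If `c_{n′}(P) = res ξ′` lies in `Sel^{(n′)}(E_L/L)` (e.g. `P = P_1 = y`,
or a Kolyvagin class with no bad primes), then `[2]_* ξ′ ∈ Sel^{(d)}(E/K₀)` and restricts to `c_d(P)`.
[cite: McCallumLMS1991, §4 Lemma 4.3 and Lemma 4.6] [cite: DokchitserDokchitserAnnals2010, Lemma 4.14 (proof)] -/
theorem torsionH1ZSMul_two_mem_selmerGroup_and_resTorsion_eq_kolyvaginClass
    (h2 : Module.finrank K₀ L ≤ 2) {d n' : ℤ} (hm : n' ∣ d * 2) (hdm : d * 2 = n')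
    (hdiv' : ∀ P : geomPoints (W.baseChange L), ∃ Q : geomPoints (W.baseChange L), n' • Q = P)
    {A : AddSubgroup (geomPoints (W.baseChange L))}
    (hA' : IsAdmissible (Field.absoluteGaloisGroup L) A n') {P : geomPoints (W.baseChange L)}
    (hP' : P ∈ invPoints (Field.absoluteGaloisGroup L) A n')
    {ξ' : galH1Torsion W n'}
    (hξ' : resTorsion W L n' ξ' = kolyvaginClass (W.baseChange L) n' hdiv' hA' P hP')
    (hSel : kolyvaginClass (W.baseChange L) n' hdiv' hA' P hP' ∈ selmerGroup (W.baseChange L) n') :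
    torsionH1ZSMul W 2 hm ξ' ∈ selmerGroup W d ∧
      resTorsion W L d (torsionH1ZSMul W 2 hm ξ') =
        kolyvaginClass (W.baseChange L) d (exists_zsmul_eq_of_eq_mul (W.baseChange L) 2 hdm hdiv')
          (hA'.of_eq_mul 2 hdm) P (mem_invPoints_of_eq_mul 2 hdm hP') := by
  refine ⟨torsionH1ZSMul_two_mem_selmerGroup_of_resTorsion_mem W L h2 hm (by rw [hξ']; exact hSel),
    ?_⟩
  rw [resTorsion_torsionH1ZSMul, hξ', torsionH1ZSMul_two_kolyvaginClass (W.baseChange L) hm hdm]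

end Descent

end Literature.NumberTheory.EllipticCurves

end
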